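import Mathlib.Analysis.SpecialFunctions.Complex.Arg
import Literature.Geometry.MetricEmbeddings.HeisenbergLines
import HarnessLib

/-!
# The horizontal plane `H_p` and horizontal joinability in `ℍ`

Family `pnp`, layer `Literature/Geometry/MetricEmbeddings`; sibling proofs file (theorems only) of
`HeisenbergLines.lean` (`HeisK.horizontal θ t`, the horizontal one-parameter subgroups; their left
cosets are the horizontal lines). Source: J. Cheeger, B. Kleiner, A. Naor, arXiv:0910.2026 = Acta
Math. 207 (2011), §2 (arXiv p. 8: the horizontal subspace `H_x`, "the horizontal lines are a certain
codimension `1` subset of all the lines") and §8 "Properties of pairs of lines" (arXiv p. 22: "for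
`x ∈ L_1`, there is a unique `x* ∈ L_2`, such that `x, x*` lie on a line `L(x) ∈ lines(ℍ)`"; "the
collection of unit tangent vectors to the collection of horizontal geodesics at `p` is a circle").

PROVED here (no named facts), in the coordinates `(a,b,c) = (x, y, 2z − xy)` of [CKN]
(`HeisK.ckn`):

* `HeisK.exists_horizontal_eq_iff`: the union of the horizontal subgroups is the horizontal plane
  `H_1 = {c = 0}`;
* `HeisK.exists_mul_horizontal_eq_iff`, `HeisK.range_mul_horizontal`: **`p` and `q` lie on a common
  horizontal line iff `q ∈ H_p = {c_q − c_p = a_p b_q − b_p a_q}`**, a Euclidean plane through `p`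
  swept by the horizontal lines through `p`; `HeisK.image_mul_horizontalPlane`: `g H_p = H_{gp}`;
* `HeisK.horizontal_line_eq_of_eq`, `HeisK.horizontal_line_through_unique`: **two distinct points lie
  on at most one horizontal line**.

NOT here: parallel and skew pairs of lines, the ruled surface `X(L_1,L_2)` and the hyperbola
`Y(L_1,L_2)` of [CKN Lemmas 34–35].

## References

* [CheegerKleinerNaor2011] J. Cheeger, B. Kleiner, A. Naor, Acta Math. 207 (2011) 291–373, §§2, 8
  (arXiv:0910.2026 pp. 8, 22).
-/

noncomputable section

open Set Real

namespace Literature.Geometry.MetricEmbeddings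

namespace HeisK

/-- Polar form of a planar vector. [folklore] -/
theorem exists_polar (u v : ℝ) : ∃ t θ : ℝ, u = t * Real.cos θ ∧ v = t * Real.sin θ := by
  exact ⟨‖(⟨u, v⟩ : ℂ)‖, Complex.arg ⟨u, v⟩, (Complex.norm_mul_cos_arg (⟨u, v⟩ : ℂ)).symm,
    (Complex.norm_mul_sin_arg (⟨u, v⟩ : ℂ)).symm⟩

/-- The elements reachable from the identity along a horizontal subgroup are exactly those with
`c = 2z − xy = 0`, i.e. `z = xy/2`: `(u, v, uv/2) = γ_θ(t)` for `(u, v) = t(cos θ, sin θ)` — the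
**horizontal plane `H_1 = {c = 0}`** in the coordinates of [CKN]. [cite: CheegerKleinerNaor2011, §2 (arXiv p. 8)] -/
theorem exists_horizontal_eq_iff (q : HeisK) :
    (∃ θ t : ℝ, horizontal θ t = q) ↔ 2 * q.z - q.x * q.y = 0 := by
  constructor
  · rintro ⟨θ, t, rfl⟩
    simp only [horizontal_x, horizontal_y, horizontal_z]
    ring
  · intro h
    obtain ⟨t, θ, hx, hy⟩ := exists_polar q.x q.y
    refine ⟨θ, t, ?_⟩
    ext
    · simp [hx]
    · simp [hy]
    · simp only [horizontal_z]
      have hz : q.z = q.x * q.y / 2 := by linarith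
      rw [hz, hx, hy]; ring

/-- **Horizontal joinability**: two points `p, q ∈ ℍ` lie on a common horizontal line iff `q` lies in
the horizontal plane through `p`, `H_p = {q | c_q − c_p = a_p b_q − b_p a_q}` in the coordinates
`(a,b,c) = (x, y, 2z−xy)` of [CKN] (a Euclidean plane through `p`; "the collection of unit tangent
vectors to the collection of horizontal geodesics at `p` is a circle", [CKN §8]).
[cite: CheegerKleinerNaor2011, §2 (arXiv p. 8)] -/
theorem exists_mul_horizontal_eq_iff (p q : HeisK) :
    (∃ θ t : ℝ, p * horizontal θ t = q) ↔
      (2 * q.z - q.x * q.y) - (2 * p.z - p.x * p.y) = p.x * q.y - p.y * q.x := by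
  have key : (∃ θ t : ℝ, p * horizontal θ t = q) ↔ ∃ θ t : ℝ, horizontal θ t = p⁻¹ * q := by
    constructor
    · rintro ⟨θ, t, h⟩; exact ⟨θ, t, by rw [← h, inv_mul_cancel_left]⟩
    · rintro ⟨θ, t, h⟩; exact ⟨θ, t, by rw [h, mul_inv_cancel_left]⟩
  rw [key, exists_horizontal_eq_iff]
  simp only [mul_x, mul_y, mul_z, inv_x, inv_y, inv_z]
  constructor <;> intro h <;> linarith [h]

/-- The horizontal plane through `p` is swept by the horizontal lines through `p`: it is the image
of `(θ, t) ↦ p γ_θ(t)`. [cite: CheegerKleinerNaor2011, §2 (arXiv p. 8)] -/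
theorem range_mul_horizontal (p : HeisK) :
    Set.range (fun θt : ℝ × ℝ => p * horizontal θt.1 θt.2) =
      {q : HeisK | (2 * q.z - q.x * q.y) - (2 * p.z - p.x * p.y) = p.x * q.y - p.y * q.x} := by
  ext q
  rw [Set.mem_range, Set.mem_setOf_eq, ← exists_mul_horizontal_eq_iff]
  constructor
  · rintro ⟨⟨θ, t⟩, h⟩; exact ⟨θ, t, h⟩
  · rintro ⟨θ, t, h⟩; exact ⟨⟨θ, t⟩, h⟩

/-- Distinct points on a common horizontal line determine it: if `p γ_θ(t) = p γ_θ'(t')` with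
`t ≠ 0`, then the lines `p γ_θ(ℝ)` and `p γ_θ'(ℝ)` coincide (as sets).
[cite: CheegerKleinerNaor2011, §8 (arXiv p. 22)] -/
theorem horizontal_line_eq_of_eq {θ θ' t t' : ℝ} (ht : t ≠ 0)
    (h : horizontal θ t = horizontal θ' t') :
    Set.range (horizontal θ) = Set.range (horizontal θ') := by
  -- from the first two coordinates: `t (cos θ, sin θ) = t' (cos θ', sin θ')`, so the directions agree
  -- up to sign and the subgroups (which are symmetric under `t ↦ -t`) coincide
  have hx := congrArg HeisK.x h
  have hy := congrArg HeisK.y h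
  simp only [horizontal_x, horizontal_y] at hx hy
  have ht' : t' ≠ 0 := by
    rintro rfl
    simp only [zero_mul] at hx hy
    have h1 := Real.sin_sq_add_cos_sq θ
    have : t ^ 2 * (Real.sin θ ^ 2 + Real.cos θ ^ 2) = 0 := by nlinarith [hx, hy]
    rw [h1, mul_one] at this
    exact ht (pow_eq_zero_iff two_ne_zero |>.mp this)
  -- `(cos θ', sin θ') = (t/t') (cos θ, sin θ)`, and `|t/t'| = 1`
  have hc : Real.cos θ' = (t / t') * Real.cos θ := by field_simp; linarith
  have hs : Real.sin θ' = (t / t') * Real.sin θ := by field_simp; linarith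
  have hunit : (t / t') ^ 2 = 1 := by
    have h1 := Real.sin_sq_add_cos_sq θ
    have h2 := Real.sin_sq_add_cos_sq θ'
    rw [hc, hs] at h2
    nlinarith [h1, h2]
  have key : ∀ u : ℝ, horizontal θ' u = horizontal θ ((t / t') * u) := by
    intro u
    ext
    · simp only [horizontal_x]; rw [hc]; ring
    · simp only [horizontal_y]; rw [hs]; ring
    · simp only [horizontal_z]; rw [hc, hs]; ring
  ext q
  simp only [Set.mem_range]
  constructor
  · rintro ⟨u, rfl⟩
    refine ⟨(t / t') * u, ?_⟩
    rw [key]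
    congr 1
    have : (t / t') * ((t / t') * u) = (t / t') ^ 2 * u := by ring
    rw [this, hunit, one_mul]
  · rintro ⟨u, rfl⟩
    exact ⟨(t / t') * u, (key _).symm ▸ rfl⟩

/-- **Uniqueness of the horizontal line through two points**: if `q = p γ_θ(t) = p γ_θ'(t')` with
`q ≠ p`, the two horizontal lines through `p` and `q` coincide ("for `x ∈ L_1`, there is a unique …
line", [CKN §8]; two distinct points lie on at most one horizontal line).
[cite: CheegerKleinerNaor2011, §8 (arXiv p. 22)] -/
theorem horizontal_line_through_unique {p q : HeisK} {θ θ' t t' : ℝ} (hpq : q ≠ p)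
    (h : p * horizontal θ t = q) (h' : p * horizontal θ' t' = q) :
    (fun u => p * horizontal θ u) '' Set.univ = (fun u => p * horizontal θ' u) '' Set.univ := by
  have ht : t ≠ 0 := by
    rintro rfl
    rw [horizontal_at_zero, mul_one] at h
    exact hpq h.symm
  have hh : horizontal θ t = horizontal θ' t' := mul_left_cancel (h.trans h'.symm)
  have hr := horizontal_line_eq_of_eq ht hh
  simp only [Set.image_univ]
  ext x
  constructor
  · rintro ⟨u, rfl⟩
    obtain ⟨u', hu'⟩ : horizontal θ u ∈ Set.range (horizontal θ') := hr ▸ Set.mem_range_self u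
    exact ⟨u', by simp only [hu']⟩
  · rintro ⟨u, rfl⟩
    obtain ⟨u', hu'⟩ : horizontal θ' u ∈ Set.range (horizontal θ) := hr.symm ▸ Set.mem_range_self u
    exact ⟨u', by simp only [hu']⟩

/-- The horizontal plane is left-invariantly attached: `H_{gp} = g H_p`.
[cite: CheegerKleinerNaor2011, §2 (arXiv p. 8)] -/
theorem image_mul_horizontalPlane (g p : HeisK) :
    (fun q => g * q) '' {q : HeisK | (2 * q.z - q.x * q.y) - (2 * p.z - p.x * p.y) = p.x * q.y - p.y * q.x} =
      {q : HeisK | (2 * q.z - q.x * q.y) - (2 * (g * p).z - (g * p).x * (g * p).y) =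
        (g * p).x * q.y - (g * p).y * q.x} := by
  rw [← range_mul_horizontal, ← range_mul_horizontal, ← Set.range_comp]
  congr 1
  funext θt
  simp [mul_assoc]

end HeisK

end Literature.Geometry.MetricEmbeddings

end
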